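import Literature.Computability.Complexity.BoolEncodings
import Literature.Computability.Complexity.Promise
import HarnessLib

/-!
# Label cover: regular projection `2CSP_W` instances and their gap problem `GAP 2CSP_W(ε)`

Topic `Computability/Complexity`, namespace `Literature.Computability.Complexity` (with the
`LabelCoverConstraint`, `LabelCoverInstance`, `GapLabelCover` sub-namespaces). Vendored as
the SOURCE problem of the Lund–Yannakakis reduction to gap set cover
(`LundYannakakis.lean`; Arora–Barak 2009, Thm. 22.31), i.e. the first brick under
Arora–Babai–Stern–Sweedyk 1997, Prop. 6 (`AroraEtAl1997_prop6`, `GapSetCover.lean`).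

A `2CSP_W` instance (Arora–Barak 2009, Def. 22.1 with Def. 11.11) has `n` variables with
values in `[W]` and `m` constraints each depending on two variables; it has the *projection
property* (§22.3, p. 470) when "for each constraint `φ_r` there is a function `h : [W] → [W]`
such that the constraint is satisfied by `(u, v)` iff `h(u) = v`", and it is *regular* when
"every variable appears in the same number of constraints". Bipartite projection instances
are the *label cover* instances of Arora–Babai–Stern–Sweedyk 1997, §5.1 (the name used since).

## Contents

* `LabelCoverConstraint` — a projection constraint `(i, j, h)`: first variable `fst = i`,
  second variable `snd = j`, the projection as the value list `proj = [h 0, …, h (W-1)]`;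
  `Sat C a` ("`h (a i) = a j`", a `Bool`).
* `LabelCoverInstance` — `numVars = n`, `alphabetSize = W`, the list of constraints;
  `numConstraints = m`, `satCount a = #{r | φ_r(a) = 1}`, `IsSatisfiable` (`val = 1`),
  `WellFormed` (variables `< n`, `i ≠ j`, `|proj| = W` with values `< W`, and `m ≥ 1`),
  `degree`, `IsRegular`, the Boolean `encoding`.
* `gapLabelCover W ε : PromiseProblem` — `GAP 2CSP_W(ε)` on regular projection instances:
  YES = well-formed regular instances over `[W]` with `val = 1`; NO = those in which every
  assignment satisfies fewer than `ε · m` constraints (`val < ε`); disjoint for `ε ≤ 1`.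
* NOT here (see the last design note): Raz's theorem in the form of Arora–Barak 2009,
  Thm. 22.15 — for some `c > 1` and every `t > 1`, `gapLabelCover (2^{ct}) (2^{-t})` is NP-hard —
  is quoted below but deliberately not vendored as a named fact; `GapSetCoverProofs.lean`
  proves `AroraEtAl1997_prop6` from it as an explicit hypothesis (`AroraEtAl1997_prop6_of_raz`).

## Design choices / faithfulness

* Assignments are total maps `a : ℕ → ℕ`; a constraint `(i, j, h)` is satisfied iff
  `h[a i]? = some (a j)`, so a value `a i ≥ W` never satisfies a constraint on `i` and (for
  well-formed `h`, values `< W`) a value `a j ≥ W` is never hit: quantifying the NO condition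
  over all `a : ℕ → ℕ` is the printed maximum over `[W]ⁿ`.
* `WellFormed` asks `fst ≠ snd` (a constraint "`φ_r(y₁, y₂)`" is on two variables; the
  instances of Raz's verifier are bipartite) and `m ≥ 1` (a reduction never needs to output
  the empty instance: `val` is a fraction of `m`); both are used by the Lund–Yannakakis
  analysis. `degree i` counts occurrences as first plus occurrences as second variable, so
  that `∑_{i<n} degree i = 2m`; `IsRegular` asks all `n` variables to have the same degree.
* NO is the strict form `satCount a < ε · m` of "`val(φ) < ε`" (Def. 11.13), as in
  `GapCSP.noSet`; YES does not mention `ε`. Both parts fix the alphabet size to the parameter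
  `W` (the problem is `2CSP_W`).
* Raz's theorem, Thm. 22.15 (p. 473), prints "There is a `c > 1` such that for every `t > 1`,
  `GAP 2CSP_W(ε)` is NP-hard for `ε = 2^{-t}`, `W = 2^{ct}`, and this is true also for 2CSP
  instances that are regular and have the projection property." In this vocabulary it reads
  `∃ c : ℕ, 1 < c ∧ ∀ t : ℕ, 1 < t → (gapLabelCover (2 ^ (c * t)) (1 / 2 ^ t)).IsNPHard`
  (`c t : ℕ`: an alphabet SIZE `2^{ct}` is an integer, rounding a real `c` up weakens nothing
  used downstream; NP-hardness as `PromiseProblem.IsNPHard`, Def. 11.13: for every `L ∈ NP` a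
  polynomial-time `f` with `x ∈ L ⇒ val (f x) = 1`, `x ∉ L ⇒ val (f x) < ε`, the instances
  produced being regular projection instances). It rests on the PCP theorem and on Raz's
  parallel repetition theorem (Raz 1998, Thm. 1.1), neither of which the tree proves (nor do
  Arora–Barak: §22.3.1 only sketches the idea; the tree's equality `pcp_theorem` of
  `Approximation.lean` is refuted as stated, `pcp_theorem_false`), so it is exactly as deep as
  the fact it would serve, `AroraEtAl1997_prop6` (`GapSetCover.lean`, attributed by ABSS 1997 to
  the PCP construction of Bellare–Goldwasser–Lund–Russell 1993). It is therefore NOT vendored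
  as a second named fact (D-0026): `GapSetCoverProofs.lean` proves `AroraEtAl1997_prop6` from
  the displayed statement taken as a hypothesis (`AroraEtAl1997_prop6_of_raz`, through the
  discharged Lund–Yannakakis reduction `AroraBarak2009_thm2231_holds`), which records precisely
  what separates `AroraEtAl1997_prop6` from proved mathematics.
* Mathlib has no CSP / label cover material (searched `LabelCover`, `2CSP`, `projection game`);
  the tree's `CSPInstance` (`GapCSP.lean`) is general MaxCSP with accepting-view lists, from
  which the projection maps `h_r` that the Lund–Yannakakis construction consumes are not
  directly readable, hence the dedicated (list-of-triples) instance type here.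

## References

* S. Arora, B. Barak, *Computational Complexity: A Modern Approach*, CUP 2009: Def. 11.11,
  Def. 11.13, Def. 22.1, §22.3 (projection property, regular instances), Thm. 22.15 (p. 473),
  §22.3.1 (idea of Raz's proof).
* R. Raz, *A parallel repetition theorem*, SIAM J. Comput. 27 (1998) 763–803, Thm. 1.1.
* S. Arora, L. Babai, J. Stern, Z. Sweedyk, J. Comput. Syst. Sci. 54 (1997), §5.1 (label cover).
* C. Lund, M. Yannakakis, *On the hardness of approximating minimization problems*, J. ACM 41
  (1994), §3.
-/

namespace Literature.Computability.Complexity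

open _root_.Computability

/-! ### Projection constraints and label cover instances -/

/-- A projection constraint of a `2CSP_W` instance: the first variable `fst`, the second
variable `snd`, and the projection `h : [W] → [W]` as its list of values `proj = [h 0, …]`;
it is satisfied by `(u, v)` iff `h u = v`. [cite: AroraBarak2009, §22.3 (projection property, p. 470)] -/
structure LabelCoverConstraint where
  /-- The first variable `i` of the constraint. -/
  fst : ℕ
  /-- The second variable `j` of the constraint. -/
  snd : ℕ
  /-- The projection `h`, as the list `[h 0, h 1, …, h (W - 1)]`. -/
  proj : List ℕ

namespace LabelCoverConstraint

/-- The value `h u` of the projection (junk value `0` for `u ≥ |proj|`, never used on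
well-formed data). [cite: AroraBarak2009, §22.3 (projection property, p. 470)] -/
def projAt (C : LabelCoverConstraint) (u : ℕ) : ℕ :=
  C.proj.getD u 0

/-- `C` is satisfied by the assignment `a` iff `h (a i) = a j` (with `h (a i)` defined, i.e.
`a i < |proj|`). [cite: AroraBarak2009, §22.3 (projection property, p. 470)] -/
def Sat (C : LabelCoverConstraint) (a : ℕ → ℕ) : Bool :=
  decide (C.proj[a C.fst]? = some (a C.snd))

/-- Unfolding of `Sat`. [cite: AroraBarak2009, §22.3 (projection property, p. 470)] -/
theorem sat_eq_true_iff (C : LabelCoverConstraint) (a : ℕ → ℕ) :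
    C.Sat a = true ↔ C.proj[a C.fst]? = some (a C.snd) := by
  simp [Sat]

/-- A satisfied constraint has `a i < |proj|` and `h (a i) = a j`. [cite: AroraBarak2009, §22.3 (projection property, p. 470)] -/
theorem projAt_eq_of_sat {C : LabelCoverConstraint} {a : ℕ → ℕ} (h : C.Sat a = true) :
    a C.fst < C.proj.length ∧ C.projAt (a C.fst) = a C.snd := by
  rw [sat_eq_true_iff] at h
  obtain ⟨hlt, heq⟩ := List.getElem?_eq_some_iff.1 h
  refine ⟨hlt, ?_⟩
  simp [projAt, List.getD_eq_getElem?_getD, List.getElem?_eq_getElem hlt, heq]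

/-- Conversely, `a i < |proj|` and `h (a i) = a j` satisfy the constraint. [cite: AroraBarak2009, §22.3 (projection property, p. 470)] -/
theorem sat_of_projAt_eq {C : LabelCoverConstraint} {a : ℕ → ℕ} (hlt : a C.fst < C.proj.length)
    (heq : C.projAt (a C.fst) = a C.snd) : C.Sat a = true := by
  rw [sat_eq_true_iff, List.getElem?_eq_getElem hlt]
  simp only [projAt, List.getD_eq_getElem?_getD, List.getElem?_eq_getElem hlt,
    Option.getD_some] at heq
  rw [heq]

/-- Well-formed constraints over `n` variables and the alphabet `[W]`: both variables `< n`
and distinct, and `proj` is a map `[W] → [W]` (length `W`, values `< W`).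
[cite: AroraBarak2009, Def. 22.1 and §22.3 (p. 470)] -/
def WellFormed (n W : ℕ) (C : LabelCoverConstraint) : Prop :=
  C.fst < n ∧ C.snd < n ∧ C.fst ≠ C.snd ∧ C.proj.length = W ∧ ∀ v ∈ C.proj, v < W

/-- Well-formedness of a constraint is decidable. [folklore] -/
instance decidableWellFormed (n W : ℕ) (C : LabelCoverConstraint) :
    Decidable (C.WellFormed n W) := by
  unfold WellFormed
  infer_instance

/-- On well-formed data the projection takes values `< W`. [cite: AroraBarak2009, §22.3 (p. 470)] -/
theorem WellFormed.projAt_lt {n W : ℕ} {C : LabelCoverConstraint} (h : C.WellFormed n W) {u : ℕ}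
    (hu : u < W) : C.projAt u < W := by
  obtain ⟨-, -, -, hlen, hval⟩ := h
  have hu' : u < C.proj.length := hlen ▸ hu
  simp only [projAt, List.getD_eq_getElem?_getD, List.getElem?_eq_getElem hu', Option.getD_some]
  exact hval _ (List.getElem_mem hu')

end LabelCoverConstraint

/-- A LABEL COVER instance, i.e. an instance of `2CSP_W` with the projection property: `n`
variables with values in `[W] = {0, …, W-1}` and the list of projection constraints
`φ_0, …, φ_{m-1}`. [cite: AroraBarak2009, Def. 22.1 and §22.3 (p. 470)] -/
structure LabelCoverInstance where
  /-- The number `n` of variables. -/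
  numVars : ℕ
  /-- The alphabet size `W`. -/
  alphabetSize : ℕ
  /-- The constraints `φ_0, …, φ_{m-1}`. -/
  constraints : List LabelCoverConstraint

namespace LabelCoverInstance

/-- The number `m` of constraints (the size of the instance). [cite: AroraBarak2009, Def. 11.11 (Note 1)] -/
def numConstraints (φ : LabelCoverInstance) : ℕ :=
  φ.constraints.length

/-- The number of constraints satisfied by `a`, so that the fraction of satisfied constraints
is `satCount a / m` and `val φ` its maximum. [cite: AroraBarak2009, Def. 11.11] -/
def satCount (φ : LabelCoverInstance) (a : ℕ → ℕ) : ℕ :=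
  φ.constraints.countP fun C => C.Sat a

/-- `φ` is satisfiable (`val φ = 1`): some assignment satisfies every constraint.
[cite: AroraBarak2009, Def. 11.11] -/
def IsSatisfiable (φ : LabelCoverInstance) : Prop :=
  ∃ a : ℕ → ℕ, ∀ C ∈ φ.constraints, C.Sat a = true

/-- Well-formed instances: at least one constraint, and every constraint is well formed over
`n` variables and the alphabet `[W]`. [cite: AroraBarak2009, Def. 22.1 and §22.3 (p. 470)] -/
def WellFormed (φ : LabelCoverInstance) : Prop :=
  0 < φ.numConstraints ∧ ∀ C ∈ φ.constraints, C.WellFormed φ.numVars φ.alphabetSize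

/-- The number of constraints in which the variable `i` appears (occurrences as first
variable plus occurrences as second variable). [cite: AroraBarak2009, §22.3 (regular instances, p. 470)] -/
def degree (φ : LabelCoverInstance) (i : ℕ) : ℕ :=
  (φ.constraints.countP fun C => C.fst = i) + φ.constraints.countP fun C => C.snd = i

/-- `φ` is REGULAR: "every variable appears in the same number of constraints".
[cite: AroraBarak2009, §22.3 (regular instances, p. 470)] -/
def IsRegular (φ : LabelCoverInstance) : Prop :=
  ∃ d : ℕ, ∀ i < φ.numVars, φ.degree i = d

/-- Well-formedness of an instance is decidable. [folklore] -/
instance decidableWellFormed (φ : LabelCoverInstance) : Decidable φ.WellFormed := by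
  unfold WellFormed
  infer_instance

/-- `satCount` is at most the number of constraints. [folklore] -/
theorem satCount_le_numConstraints (φ : LabelCoverInstance) (a : ℕ → ℕ) :
    φ.satCount a ≤ φ.numConstraints :=
  List.countP_le_length

/-- All constraints are satisfied by `a` iff `satCount a = m`. [folklore] -/
theorem satCount_eq_numConstraints_iff (φ : LabelCoverInstance) (a : ℕ → ℕ) :
    φ.satCount a = φ.numConstraints ↔ ∀ C ∈ φ.constraints, C.Sat a = true := by
  simp [satCount, numConstraints, List.countP_eq_length]

/-- A well-formed instance has at least one variable (its first constraint names one). [folklore] -/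
theorem WellFormed.numVars_pos {φ : LabelCoverInstance} (h : φ.WellFormed) : 0 < φ.numVars := by
  obtain ⟨hm, hC⟩ := h
  obtain ⟨C, hCmem⟩ := List.exists_mem_of_length_pos hm
  exact lt_of_le_of_lt (Nat.zero_le _) (hC C hCmem).1

/-! ### Boolean encoding of instances -/

/-- The instance as the tuple `(n, W, [(iᵣ, jᵣ, hᵣ)]ᵣ)`. [folklore] -/
def toTuple (φ : LabelCoverInstance) : ℕ × ℕ × List (ℕ × ℕ × List ℕ) :=
  (φ.numVars, φ.alphabetSize, φ.constraints.map fun C => (C.fst, C.snd, C.proj))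

/-- The instance with tuple `(n, W, [(iᵣ, jᵣ, hᵣ)]ᵣ)`. [folklore] -/
def ofTuple (t : ℕ × ℕ × List (ℕ × ℕ × List ℕ)) : LabelCoverInstance :=
  ⟨t.1, t.2.1, t.2.2.map fun c => ⟨c.1, c.2.1, c.2.2⟩⟩

/-- `ofTuple` inverts `toTuple`. [folklore] -/
@[simp] theorem ofTuple_toTuple (φ : LabelCoverInstance) : ofTuple φ.toTuple = φ := by
  obtain ⟨n, W, cs⟩ := φ
  simp only [toTuple, ofTuple, List.map_map, mk.injEq, true_and]
  conv_rhs => rw [← List.map_id cs]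
  exact List.map_congr_left fun C _ => rfl

/-- `toTuple` inverts `ofTuple`. [folklore] -/
@[simp] theorem toTuple_ofTuple (t : ℕ × ℕ × List (ℕ × ℕ × List ℕ)) :
    (ofTuple t).toTuple = t := by
  obtain ⟨n, W, cs⟩ := t
  simp only [toTuple, ofTuple, List.map_map, Prod.mk.injEq, true_and]
  conv_rhs => rw [← List.map_id cs]
  exact List.map_congr_left fun c _ => rfl

/-- The Boolean encoding of the tuple `(n, W, [(iᵣ, jᵣ, hᵣ)]ᵣ)` (numbers in binary, lists as
`listBool` codes). [folklore] -/
def tupleEncoding : Encoding (ℕ × ℕ × List (ℕ × ℕ × List ℕ)) Bool :=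
  encodingNatBool.pairBool
    (encodingNatBool.pairBool
      (encodingNatBool.pairBool (encodingNatBool.pairBool encodingNatBool.listBool)).listBool)

/-- The Boolean encoding of label cover instances (through `toTuple`/`ofTuple` and
`tupleEncoding`). [folklore] -/
def encoding : Encoding LabelCoverInstance Bool where
  encode φ := tupleEncoding.encode φ.toTuple
  decode v := (tupleEncoding.decode v).map ofTuple
  decode_encode φ := by simp [tupleEncoding.decode_encode]

/-- The encoding of an instance is the tuple code (definitional). [folklore] -/
theorem encoding_encode (φ : LabelCoverInstance) :
    encoding.encode φ = tupleEncoding.encode φ.toTuple := rfl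

end LabelCoverInstance

/-! ### The gap problem `GAP 2CSP_W(ε)` on regular projection instances -/

namespace GapLabelCover

/-- YES instances of `GAP 2CSP_W(ε)` on regular projection instances: well-formed regular
instances over the alphabet `[W]` with `val = 1`. [cite: AroraBarak2009, Def. 11.13 and Thm. 22.15 (p. 473)] -/
def yesSet (W : ℕ) : Set LabelCoverInstance :=
  {φ | φ.WellFormed ∧ φ.alphabetSize = W ∧ φ.IsRegular ∧ φ.IsSatisfiable}

/-- NO instances of `GAP 2CSP_W(ε)` on regular projection instances: well-formed regular
instances over `[W]` with `val < ε`, i.e. every assignment satisfies fewer than `ε · m`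
constraints. [cite: AroraBarak2009, Def. 11.13 and Thm. 22.15 (p. 473)] -/
def noSet (W : ℕ) (ε : ℝ) : Set LabelCoverInstance :=
  {φ | φ.WellFormed ∧ φ.alphabetSize = W ∧ φ.IsRegular ∧
    ∀ a : ℕ → ℕ, (φ.satCount a : ℝ) < ε * φ.numConstraints}

/-- The no-part grows with `ε`. [cite: AroraBarak2009, Def. 11.13] -/
theorem noSet_mono (W : ℕ) {ε ε' : ℝ} (h : ε ≤ ε') : noSet W ε ⊆ noSet W ε' := by
  rintro φ ⟨hwf, hW, hreg, hno⟩
  exact ⟨hwf, hW, hreg, fun a =>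
    (hno a).trans_le (mul_le_mul_of_nonneg_right h (Nat.cast_nonneg _))⟩

/-- For `ε ≤ 1` the YES and NO instances are disjoint: a satisfying assignment satisfies all
`m` constraints, never fewer than `ε · m ≤ m`. [cite: AroraBarak2009, Def. 11.13] -/
theorem disjoint_yesSet_noSet (W : ℕ) {ε : ℝ} (hε : ε ≤ 1) : Disjoint (yesSet W) (noSet W ε) := by
  refine Set.disjoint_left.2 ?_
  rintro φ ⟨-, -, -, a, ha⟩ ⟨-, -, -, hno⟩
  have hsat : (φ.satCount a : ℝ) = φ.numConstraints := by
    exact_mod_cast (φ.satCount_eq_numConstraints_iff a).2 ha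
  have h := hno a
  rw [hsat] at h
  have : ε * φ.numConstraints ≤ 1 * φ.numConstraints :=
    mul_le_mul_of_nonneg_right hε (Nat.cast_nonneg _)
  rw [one_mul] at this
  exact absurd (h.trans_le this) (lt_irrefl _)

end GapLabelCover

/-- The promise problem **`GAP 2CSP_W(ε)` on regular projection instances** (gap label cover)
over `{0,1}`: YES = codes of `GapLabelCover.yesSet W` (`val = 1`), NO = codes of
`GapLabelCover.noSet W ε` (`val < ε`), under `LabelCoverInstance.encoding`.
[cite: AroraBarak2009, Def. 11.13, Def. 22.1 and Thm. 22.15 (p. 473)] -/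
def gapLabelCover (W : ℕ) (ε : ℝ) : PromiseProblem :=
  PromiseProblem.ofEncoding LabelCoverInstance.encoding (GapLabelCover.yesSet W)
    (GapLabelCover.noSet W ε)

/-- The yes-part of `gapLabelCover W ε` (definitional). [cite: AroraBarak2009, Thm. 22.15 (p. 473)] -/
@[simp] theorem gapLabelCover_yes (W : ℕ) (ε : ℝ) :
    (gapLabelCover W ε).yes = LabelCoverInstance.encoding.toLanguage (GapLabelCover.yesSet W) :=
  rfl

/-- The no-part of `gapLabelCover W ε` (definitional). [cite: AroraBarak2009, Thm. 22.15 (p. 473)] -/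
@[simp] theorem gapLabelCover_no (W : ℕ) (ε : ℝ) :
    (gapLabelCover W ε).no = LabelCoverInstance.encoding.toLanguage (GapLabelCover.noSet W ε) :=
  rfl

/-- For `ε ≤ 1`, `gapLabelCover W ε` is a genuine (disjoint) promise problem.
[cite: AroraBarak2009, Def. 11.13] -/
theorem gapLabelCover_disjoint (W : ℕ) {ε : ℝ} (hε : ε ≤ 1) : (gapLabelCover W ε).Disjoint :=
  PromiseProblem.disjoint_ofEncoding _ (GapLabelCover.disjoint_yesSet_noSet W hε)

/-- Hardness transfers to larger soundness error: a reduction to `gapLabelCover W ε` is one to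
`gapLabelCover W ε'` for `ε ≤ ε'`. [cite: AroraBarak2009, Def. 11.13] -/
theorem PromiseProblem.PolyTimeReducible.gapLabelCover_mono {Q : PromiseProblem} {W : ℕ}
    {ε ε' : ℝ} (h : Q.PolyTimeReducible (gapLabelCover W ε)) (hε : ε ≤ ε') :
    Q.PolyTimeReducible (gapLabelCover W ε') := by
  obtain ⟨f, hf, hy, hn⟩ := h
  refine ⟨f, hf, hy, fun x hx => ?_⟩
  exact Encoding.toLanguage_mono _ (GapLabelCover.noSet_mono W hε) (hn hx)

end Literature.Computability.Complexity
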